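import Summits.QuantumFields.GaugeBoot.StrongCouplingPlaquetteSUNThird
import Summits.QuantumFields.GaugeBoot.StrongCouplingPlaquetteDLRWindow
import HarnessLib

/-!
# Strong coupling from the loop equation: the third-order `SU(N)` plaquette (`N ≥ 4`) at every infinite-volume limit point and DLR state (gauge-boot, ADDENDUM 25 part G)

HONEST FRAMING (cell `pub-gaugeboot`, page 1 of every file): the venture produces certified bounds
on lattice expectations at stated coupling, gauge group, dimension and torus size; NOT a mass gap,
NOT a continuum limit, NOT a string tension; NOT Yang–Mills-summit-bearing (barriers
`FixedCouplingUltralocality`, `PerturbativeInvisibility`).  Analytic STRONG-COUPLING bounds, uniform in the volume, hence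
valid at every thermodynamic limit point; informative only for small `β_std`; no number of CERTIFIED.md is touched.

## Content (`SU(N)`, `N ≥ 4`, fundamental representation, `D ≥ 2`, standard coupling `β_std`, tree coupling `β_std/N`)

The torus bound `|plaquetteExpectation N D L β_std − β_std/(2N²)| ≤ D²(D−1)|β_std|³/N²` of
`StrongCouplingPlaquetteSUNThird` holds for EVERY torus side `L ≥ 2`, so it passes (transfer lemma of
`StrongCouplingPlaquetteLimit`) to every weak limit point of the torus Wilson states and — in the tree's Dobrushin
window `6(D−1)|β_std| < 1`, where every DLR state is such a limit point — to every DLR state: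

* ★★★ `abs_integral_plaquette_suN_third_le_of_mem_limitPoints` — for every `μ ∈ infiniteVolumeLimitPoints (suRep N) (β_std/N)`
  and every plaquette of `ℤ^D`: `|∫ (1/N)Re tr U_P dμ − β_std/(2N²)| ≤ D²(D−1)|β_std|³/N²`;
* ★★★ `abs_integral_plaquette_suN_third_le_of_mem_ymGibbsMeasures` — the same for every `μ ∈ 𝒢(β_std/N)` when
  `6(D−1)|β_std| < 1`;
* ★★ `plaquetteWindow_suN_third` — the cell's TARGET SHAPE (A) at strong coupling through third order:
  `PlaquetteWindow N D L₀ β (β/(2N²) − D²(D−1)|β|³/N²) (β/(2N²) + D²(D−1)|β|³/N²)` for every `L₀ ≥ 2`, every real `β`;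
  `SU(4)`, `D = 4`: `PlaquetteWindow 4 4 L₀ β (β/32 − 3|β|³) (β/32 + 3|β|³)`.

References: R. Balian, J.-M. Drouffe, C. Itzykson, Phys. Rev. D 11 (1975) 2104; K. Osterwalder, E. Seiler, Ann. Phys. 110 (1978)
440 (strong-coupling cluster expansion).  Everything is `[folklore]`.
-/

noncomputable section

open MeasureTheory Filter Topology
open Literature.MathematicalPhysics.QuantumFieldTheory
open Literature.MathematicalPhysics.QuantumLattice (LGConfig plaquetteObs infiniteVolumeLimitPoints ymGibbsMeasures)

namespace Summit.QuantumFields.GaugeBoot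

namespace StrongCoupling

/-- ★★★ **Third order at every infinite-volume limit point, `SU(N)`, `N ≥ 4`**: for `D ≥ 2`, every real `β_std`, every
`μ ∈ infiniteVolumeLimitPoints (suRep N) (β_std/N)` and every plaquette of `ℤ^D`,
`|∫ (1/N)Re tr U_P dμ − β_std/(2N²)| ≤ D²(D−1)|β_std|³/N²`. [folklore] -/
theorem abs_integral_plaquette_suN_third_le_of_mem_limitPoints {N D : ℕ} (hN : 4 ≤ N) (hD : 2 ≤ D) (β : ℝ)
    {μ : Measure (LGConfig D (SU N))} (hμ : μ ∈ infiniteVolumeLimitPoints (d := D) (suRep N) (β / N))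
    (x : Literature.Probability.LatticeModels.Site D) {i j : Fin D} (hij : i ≠ j) :
    |∫ U, (N : ℝ)⁻¹ * plaquetteObs (suRep N) x i j U ∂μ - β / (2 * (N : ℝ) ^ 2)| ≤
      (D : ℝ) ^ 2 * ((D : ℝ) - 1) * |β| ^ 3 / (N : ℝ) ^ 2 :=
  abs_integral_plaquette_sub_le_of_forall (N := N) (D := D) (c := β / (2 * (N : ℝ) ^ 2))
    (K := (D : ℝ) ^ 2 * ((D : ℝ) - 1) * |β| ^ 3 / (N : ℝ) ^ 2) (by omega)
    (fun L _ hL => abs_plaquetteExpectation_suN_third_le hN hL hD β) hμ x hij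

/-- `SU(4)`, `D = 4`, at every infinite-volume limit point: `|∫ ¼Re tr U_P dμ − β_std/32| ≤ 3|β_std|³`. [folklore] -/
theorem abs_integral_plaquette_su4_third_le_of_mem_limitPoints_four (β : ℝ) {μ : Measure (LGConfig 4 (SU 4))}
    (hμ : μ ∈ infiniteVolumeLimitPoints (d := 4) (suRep 4) (β / 4)) (x : Literature.Probability.LatticeModels.Site 4)
    {i j : Fin 4} (hij : i ≠ j) :
    |∫ U, (4 : ℝ)⁻¹ * plaquetteObs (suRep 4) x i j U ∂μ - β / 32| ≤ 3 * |β| ^ 3 := by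
  have h := abs_integral_plaquette_suN_third_le_of_mem_limitPoints (N := 4) (D := 4) le_rfl (by norm_num) β
    (by simpa using hμ) x hij
  norm_num at h
  linarith

/-- ★★★ **Third order for every DLR state in the uniqueness window, `SU(N)`, `N ≥ 4`**: for `D ≥ 2`, `6(D−1)|β_std| < 1`,
every `μ ∈ 𝒢(β_std/N)` on `ℤ^D` and every plaquette: `|∫ (1/N)Re tr U_P dμ − β_std/(2N²)| ≤ D²(D−1)|β_std|³/N²`. [folklore] -/
theorem abs_integral_plaquette_suN_third_le_of_mem_ymGibbsMeasures {N D : ℕ} (hN : 4 ≤ N) (hD : 2 ≤ D) {β : ℝ}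
    (hβ : 6 * ((D : ℝ) - 1) * |β| < 1) {μ : Measure (LGConfig D (SU N))} (hμ : μ ∈ ymGibbsMeasures (d := D) (suRep N) (β / N))
    (x : Literature.Probability.LatticeModels.Site D) {i j : Fin D} (hij : i ≠ j) :
    |∫ U, (N : ℝ)⁻¹ * plaquetteObs (suRep N) x i j U ∂μ - β / (2 * (N : ℝ) ^ 2)| ≤
      (D : ℝ) ^ 2 * ((D : ℝ) - 1) * |β| ^ 3 / (N : ℝ) ^ 2 :=
  abs_integral_plaquette_suN_third_le_of_mem_limitPoints hN hD β
    (mem_limitPoints_of_mem_ymGibbsMeasures_of_small (N := N) (D := D) (by omega) (by omega) hβ hμ) x hij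

/-- `SU(4)`, `D = 4`, `|β_std| < 1/18`, every DLR state: `|∫ ¼Re tr U_P dμ − β_std/32| ≤ 3|β_std|³`. [folklore] -/
theorem abs_integral_plaquette_su4_third_le_of_mem_ymGibbsMeasures_four {β : ℝ} (hβ : 18 * |β| < 1)
    {μ : Measure (LGConfig 4 (SU 4))} (hμ : μ ∈ ymGibbsMeasures (d := 4) (suRep 4) (β / 4))
    (x : Literature.Probability.LatticeModels.Site 4) {i j : Fin 4} (hij : i ≠ j) :
    |∫ U, (4 : ℝ)⁻¹ * plaquetteObs (suRep 4) x i j U ∂μ - β / 32| ≤ 3 * |β| ^ 3 := by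
  have hlim := mem_limitPoints_of_mem_ymGibbsMeasures_of_small (N := 4) (D := 4) (by norm_num) (by norm_num)
    (by norm_num; linarith) hμ
  exact abs_integral_plaquette_su4_third_le_of_mem_limitPoints_four β (by simpa using hlim) x hij

/-! ## The cell's target shape (A) through third order -/

/-- ★★ **Analytic strong-coupling window through third order, shape (A), `SU(N)`, `N ≥ 4`**: for `D ≥ 2`, every `L₀ ≥ 2`
and every real `β_std`, `PlaquetteWindow N D L₀ β (β/(2N²) − D²(D−1)|β|³/N²) (β/(2N²) + D²(D−1)|β|³/N²)`. [folklore] -/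
theorem plaquetteWindow_suN_third {N D L₀ : ℕ} (hN : 4 ≤ N) (hD : 2 ≤ D) (hL₀ : 2 ≤ L₀) (β : ℝ) :
    PlaquetteWindow N D L₀ β (β / (2 * (N : ℝ) ^ 2) - (D : ℝ) ^ 2 * ((D : ℝ) - 1) * |β| ^ 3 / (N : ℝ) ^ 2)
      (β / (2 * (N : ℝ) ^ 2) + (D : ℝ) ^ 2 * ((D : ℝ) - 1) * |β| ^ 3 / (N : ℝ) ^ 2) := by
  intro L _ _ hL
  have h := abs_plaquetteExpectation_suN_third_le (N := N) (D := D) (L := L) hN (hL₀.trans hL) hD β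
  rw [abs_sub_le_iff] at h
  constructor <;> linarith [h.1, h.2]

/-- `SU(4)`, `D = 4`, shape (A): `PlaquetteWindow 4 4 L₀ β (β/32 − 3|β|³) (β/32 + 3|β|³)` for every `L₀ ≥ 2` and every real
`β` — e.g. `β_std = 1/10`: `⟨ū_P⟩ ∈ [1/320 − 3/1000, 1/320 + 3/1000]` on every torus of side `≥ 2`. [folklore] -/
theorem plaquetteWindow_su4_third_four {L₀ : ℕ} (hL₀ : 2 ≤ L₀) (β : ℝ) :
    PlaquetteWindow 4 4 L₀ β (β / 32 - 3 * |β| ^ 3) (β / 32 + 3 * |β| ^ 3) := by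
  intro L _ _ hL
  have h := abs_plaquetteExpectation_four_four_third_le (L := L) (hL₀.trans hL) β
  rw [abs_sub_le_iff] at h
  constructor <;> linarith [h.1, h.2]

end StrongCoupling

end Summit.QuantumFields.GaugeBoot

end
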